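import Literature.NumberTheory.Automorphic.PatrikisCMDescent
import Literature.NumberTheory.Automorphic.ClozelAlgebraicityConjugatesProofs
import Literature.NumberTheory.Automorphic.AlgebraicityTwist
import Literature.NumberTheory.NumberFields.CMDescentEmbeddings
import Literature.FieldTheory.AlgClosed.AutFixedSubfield
import HarnessLib

/-!
# Patrikis's CM descent of the infinity type: the proof, modulo Clozel's theorem (proofs)

Proofs-only companion (theorems, no definitions, no named facts) of `PatrikisCMDescent.lean`,
whose named fact `Patrikis2019_cmDescent` (Patrikis 2019, Prop. 2.4.7 with Rem. 2.4.8 (1);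
arXiv:1207.6724 §3.2) says: for `F` totally imaginary and `π` a cuspidal automorphic
representation of `GL_n(𝔸_F)` with a regular, C- or L-algebraic infinity type `T`, the
`a`-multisets of `T` at two embeddings `ι ι' : F → ℂ` agreeing on `F_cm` coincide.

The printed proof (read from the held text, `paper:arxiv-1207.6724`, §3.2) has two halves:

1. (Galois theory) for `E ⊂ ℂ` a CM number field — in print the Galois closure of `ℚ(π_f)`,
   CM by Cor. 2.4.6 — the automorphisms `σ ∈ Aut(ℂ/E)` act transitively on the embeddings
   `F ↪ ℂ` above a fixed embedding of `F_cm`. This half is PROVED in the tree: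
   `Literature.NumberTheory.NumberFields.exists_algEquiv_apply_eq_of_forall_isCMField_or_isTotallyReal`
   (`NumberFields/CMDescentEmbeddings`; it needs `E` totally real or CM only, no Galois closure).
2. (automorphic input: the Hypothesis of §2.4 = "the conclusion of Clozel's theorem" = Clozel
   1990, Thm. 3.13; arXiv Thm. 3.2.1, Hyp. 3.2.2) for `σ ∈ Aut(ℂ/E)`, `^σπ ≅ π` and hence `^σM = M`, i.e.
   `μ_ι = μ_{σ⁻¹ι}`; so for `ι' = σ⁻¹ι` as in (1), `μ_ι = μ_{ι'}`.

Accordingly this file proves, sorry-free: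

* `InfinityType.map_a_eq_of_autConj_invariance` — **Prop. 2.4.7 from its automorphic input**:
  if the `a`-multisets of an infinity type `T` are invariant under `^σ(·)` for all
  `σ ∈ Aut(ℂ/E)`, `E ⊆ ℂ` finite over `ℚ` and totally real or CM, then they agree at any two
  embeddings agreeing on every CM-or-totally-real subfield of `F` (half (1) + one line);
* `Clozel1990_regularAlgebraic.map_a_autConj_eq_of_fix_ratField` — half (2) in the tree's
  rendering: under the named fact `Clozel1990_regularAlgebraic` (Clozel Thm. 3.13 (i), (ii), (iv)
  as vendored in `ClozelAlgebraicity`), and granted for the cuspidal regular algebraic `π`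
  (a) `Aut(ℂ/ℚ(π_f)) ≤ {σ : ^σπ_f ≅ π_f}` (`heckeStabilizer`) — Clozel Thm. 3.13's MODEL of
  `π_f` over `ℚ(π_f)`, the clause the vendored fact deliberately omits ("Deliberately NOT here:
  the existence of a MODEL of `π_f` over `ℚ(π_f)`", module docstring of `ClozelAlgebraicity`) —
  and (b) strong multiplicity one WITH the archimedean components (Jacquet–Shalika 1981,
  §4; Piatetski-Shapiro 1979: nearly equivalent cuspidal representations are isomorphic,
  in particular have the same infinity type — read on `a`-multisets), the `a`-multisets of every
  regular algebraic infinity type `T` of `π` are `Aut(ℂ/ℚ(π_f))`-invariant;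
* `Patrikis2019_cmDescent_of_clozel` — **the named fact from these inputs**: `Clozel1990_regularAlgebraic`,
  (a) and (b) for all cuspidal regular algebraic `π`, imply `Patrikis2019_cmDescent`; the
  L-algebraic case is reduced to the C-algebraic one by the PROVED half-twist
  `π ⊗ |det|^{-(n-1)/2}` (`CuspidalAutomorphicRepData.exists_twist_hasInfinityType`,
  `AlgebraicityTwist`; Patrikis: "the L-algebraic analogue follows easily by twisting"), and the
  hypothesis "`F` totally imaginary" of the fact is not used (Patrikis: "for simplicity");
* (section `ModelClause`) `AutomorphicRepData.exists_heckeStabilizer_iff_forall_apply_eq`,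
  `AutomorphicRepData.exists_ratField_eq_of_eventually_mem`,
  `AutomorphicRepData.mem_heckeStabilizer_of_fix_ratField` — **(a) from the PRINTED clause of
  Clozel's theorem** ("`π_f` has a model over … `ℚ(π_f)` …, with `ℚ(π_f)` in fact a number
  field", Patrikis Thm. 3.2.1), in the eigenvalue form "at almost all places the unramified
  Hecke eigenvalues lie in a subfield `E ⊆ ℂ` finite over `ℚ`": then `heckeStabilizer π` is the
  pointwise stabiliser in `Aut(ℂ)` of a number field `E₀ ⊆ E` generated by eigenvalues,
  `ratField π = E₀`, and (a) holds (pure field theory: the fields generated by the eigenvalues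
  outside a finite set of places stabilise, `IntermediateField.exists_finset_forall_adjoin_eq`);
  `Patrikis2019_cmDescent_of_clozel_of_eigenvalueField` restates the reduction with this printed
  clause in place of (a).

What is NOT proved here (and why `Patrikis2019_cmDescent_holds` is not in this file):
Clozel's Thm. 3.13 itself (`Clozel1990_regularAlgebraic`, an unproved named fact: cuspidal
cohomology and its rational structure), its printed model / number-field-of-eigenvalues clause
(not part of the vendored fact, whose clause (i) "`ratField π` finite over `ℚ`" is too weak to
give (a): the exceptional places in `heckeStabilizer` may depend on the automorphism), and
strong multiplicity one in the `AutomorphicRepData` form (b) (the tree has strong multiplicity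
one for the `L²` model, `strong_multiplicity_one_gl…`, itself resting on the Jacquet–Shalika
facts, and no transport of infinity types along `IsAssociatedL2`). Given theorems for these
three inputs, `Patrikis2019_cmDescent_holds` is
`Patrikis2019_cmDescent_of_clozel_of_eigenvalueField` applied to them.

## References

* S. Patrikis, *Variations on a theorem of Tate*, Mem. AMS 258 (2019), no. 1238
  (= arXiv:1207.6724), §2.4: Clozel's theorem, the Hypothesis, Cor. 2.4.6, Prop. 2.4.7,
  Rem. 2.4.8 (arXiv §3.2: Thm. 3.2.1, Hyp. 3.2.2, Cor. 3.2.3, Prop. `cmdescent`, Rem. 3.2.4).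
  [Patrikis2019]
* L. Clozel, *Motifs et formes automorphes*, Perspect. Math. 10 (1990), Thm. 3.13. [Clozel1990]
* H. Jacquet, J. Shalika, *On Euler products and the classification of automorphic forms II*,
  Amer. J. Math. 103 (1981), §4. [JacquetShalika1981]
* S. Lang, *Algebra*, rev. 3rd ed., GTM 211 (2002), Ch. VIII §1 (the fixed field of `Aut(ℂ/E₀)`,
  via `FieldTheory/AlgClosed/AutFixedSubfield`). [Lang2002]
-/

noncomputable section

open scoped Classical
open NumberField IsDedekindDomain

namespace Literature.NumberTheory.Automorphic

open Literature.NumberTheory.NumberFields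

/-! ### Prop. 2.4.7 from the `Aut(ℂ/E)`-invariance of the infinity type -/

section Descent

variable {F : Type} [Field F] [NumberField F] {n : ℕ}

/-- **Patrikis 2019, Prop. 2.4.7, from its automorphic input.** Let `T` be an infinity type over
the number field `F` and `E ⊆ ℂ` a subfield, finite over `ℚ` and totally real or CM, such that
the `a`-multisets of `T` are invariant under `Aut(ℂ/E)`: `{a of ^σT at ι} = {a of T at ι}` for
every `σ` fixing `E` pointwise (`^σT = T.autConj σ = (ι ↦ T(σ⁻¹ι))`; in print: `^σπ ≅ π`, hence
`^σM = M`, for `σ ∈ Aut(ℂ/E)`, `E ⊇ ℚ(π_f)` CM). Then the `a`-multisets of `T` agree at any two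
embeddings `ι ι'` agreeing on every CM-or-totally-real subfield of `F` (i.e. on `F_cm`): by
`exists_algEquiv_apply_eq_of_forall_isCMField_or_isTotallyReal` there is `σ ∈ Aut(ℂ/E)` with
`ι' = σι`, and `μ_{ι'} = μ_{σ⁻¹ι'} = μ_ι`. [cite: Patrikis2019, Prop. 2.4.7 (Mem. AMS numbering; arXiv:1207.6724 §3.2, Prop. `cmdescent`)] -/
theorem InfinityType.map_a_eq_of_autConj_invariance (T : InfinityType F n) (E : Subfield ℂ)
    [FiniteDimensional ℚ E] (hE : IsTotallyReal E ∨ IsCMField E)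
    (hT : ∀ σ : ℂ ≃ₐ[ℚ] ℂ, (∀ z ∈ E, σ z = z) →
      ∀ ι : F →+* ℂ, (T.autConj σ ι).map ArchWeight.a = (T ι).map ArchWeight.a)
    {ι ι' : F →+* ℂ}
    (hιι' : ∀ M : Subfield F, (IsCMField M ∨ IsTotallyReal M) → ∀ x ∈ M, ι x = ι' x) :
    (T ι).map ArchWeight.a = (T ι').map ArchWeight.a := by
  obtain ⟨σ, hσE, hσι⟩ :=
    exists_algEquiv_apply_eq_of_forall_isCMField_or_isTotallyReal E hE ι ι' hιι'
  have hcomp : (σ.symm : ℂ ≃ₐ[ℚ] ℂ).toAlgHom.toRingHom.comp ι' = ι :=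
    RingHom.ext fun x ↦ σ.symm_apply_eq.mpr (hσι x).symm
  have h := hT σ hσE ι'
  rw [InfinityType.autConj_apply, hcomp] at h
  exact h

end Descent

/-! ### The automorphic input from Clozel's theorem, a model over `ℚ(π_f)`, and strong
multiplicity one -/

section Clozel

variable {n : ℕ} {K : Type} [Field K] [NumberField K] {hcpt : isCompact_glFiniteIntegralLevel n K}

/-- **`^σM = M` for `σ ∈ Aut(ℂ/ℚ(π_f))`** (Patrikis 2019, §2.4, the Hypothesis "`π` satisfies
the conclusion of Clozel's theorem" and the last line of the proof of Prop. 2.4.7), in the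
tree's rendering. Let `π` be cuspidal on `GL_n(𝔸_K)` with a
regular algebraic infinity type `T`. Assume the named fact `Clozel1990_regularAlgebraic` and, for
this `π`, (a) every `σ ∈ Aut(ℂ)` fixing `ratField π = ℚ(π_f)` pointwise lies in
`heckeStabilizer π` (`^σπ_f ≅ π_f`; Clozel 1990, Thm. 3.13: `π_f` has a model over `ℚ(π_f)`),
and (b) every cuspidal `π'` nearly equivalent to `π` has infinity types with the same
`a`-multisets as `T` (strong multiplicity one including the archimedean components,
Jacquet–Shalika 1981, §4). Then `{a of ^σT at ι} = {a of T at ι}` for every such `σ` and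
every `ι`: clause (ii) of the fact gives a cuspidal `σ`-conjugate `π'` of `π` with an infinity
type `T'` having the `a`-multisets of `^σT`; by (a) `π` is its own `σ`-conjugate
(`mem_heckeStabilizer_iff_isAutConjugate`), so `π'` is nearly equivalent to `π`
(`IsAutConjugate.isNearlyEquivalent`), and (b) identifies the `a`-multisets of `T'` and `T`.
[cite: Patrikis2019, §2.4, Clozel's theorem and the Hypothesis before Cor. 2.4.6 (arXiv:1207.6724 Thm. 3.2.1, Hyp. 3.2.2)] -/
theorem Clozel1990_regularAlgebraic.map_a_autConj_eq_of_fix_ratField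
    (hC : Clozel1990_regularAlgebraic) (π : CuspidalAutomorphicRepData n K hcpt)
    {T : InfinityType K n} (hT : π.1.HasInfinityType T) (hreg : T.IsRegularAlgebraic)
    (hmodel : ∀ σ : ℂ ≃ₐ[ℚ] ℂ, (∀ z ∈ ratField π.1, σ z = z) → σ ∈ heckeStabilizer π.1)
    (hsmo : ∀ π' : CuspidalAutomorphicRepData n K hcpt, π.1.IsNearlyEquivalent π'.1 →
      ∀ T' : InfinityType K n, π'.1.HasInfinityType T' →
        ∀ ι : K →+* ℂ, (T ι).map ArchWeight.a = (T' ι).map ArchWeight.a)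
    (σ : ℂ ≃ₐ[ℚ] ℂ) (hσ : ∀ z ∈ ratField π.1, σ z = z) (ι : K →+* ℂ) :
    (T.autConj σ ι).map ArchWeight.a = (T ι).map ArchWeight.a := by
  have hself : IsAutConjugate σ π.1 π.1 :=
    (mem_heckeStabilizer_iff_isAutConjugate π.1 σ).mp (hmodel σ hσ)
  obtain ⟨π', hc', hT'⟩ := hC.exists_autConjugate π ⟨T, hT, hreg⟩ σ
  obtain ⟨T', hT'π, ha⟩ := hT' T hT hreg
  rw [← ha ι]
  exact (hsmo π' (hself.isNearlyEquivalent hc') T' hT'π ι).symm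

/-- **`Patrikis2019_cmDescent` from Clozel's theorem, a model over `ℚ(π_f)`, and strong
multiplicity one** (Patrikis 2019, Prop. 2.4.7 with Rem. 2.4.8 (1): "if `π` is regular, this
yields an unconditional descent result for its infinity-type"). Assume `Clozel1990_regularAlgebraic`
and, for every cuspidal regular algebraic `π` on every `GL_n(𝔸_K)`, (a) `Aut(ℂ/ℚ(π_f)) ≤
heckeStabilizer π` (Clozel Thm. 3.13, model over `ℚ(π_f)`) and (b) nearly equivalent cuspidal
representations have infinity types with the same `a`-multisets (Jacquet–Shalika strong
multiplicity one with archimedean components). Then the fact holds: for `T` regular and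
C-algebraic (`IsRegularAlgebraic`), `E = ℚ(π_f) = ratField π` is finite over `ℚ` (clause (i))
and totally real or CM (clause (iv), Patrikis Cor. 2.4.6), the `a`-multisets of `T` are
`Aut(ℂ/E)`-invariant (`map_a_autConj_eq_of_fix_ratField`), and
`InfinityType.map_a_eq_of_autConj_invariance` concludes; for `T` regular and L-algebraic and
`n ≥ 1`, the cuspidal twist `π ⊗ |det|^{-(n-1)/2}` has the regular C-algebraic infinity type
`T.twist (-(n-1)/2)` (`CuspidalAutomorphicRepData.exists_twist_hasInfinityType`,
`InfinityType.isLAlgebraic_iff_isCAlgebraic_twist`, `IsRegular.twist`), whose descent is that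
of `T` shifted by `-(n-1)/2` (`map_a_twist`; "the L-algebraic analogue follows easily by
twisting"); for `n = 0` all multisets are empty. The hypothesis that `F` is totally imaginary
is not used. [cite: Patrikis2019, Prop. 2.4.7 and Rem. 2.4.8 (1) (Mem. AMS numbering; arXiv:1207.6724 §3.2)] -/
theorem Patrikis2019_cmDescent_of_clozel (hC : Clozel1990_regularAlgebraic)
    (hmodel : ∀ (n : ℕ) (K : Type) [Field K] [NumberField K]
      (hcpt : isCompact_glFiniteIntegralLevel n K) (π : CuspidalAutomorphicRepData n K hcpt),
      π.1.IsRegularAlgebraic →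
        ∀ σ : ℂ ≃ₐ[ℚ] ℂ, (∀ z ∈ ratField π.1, σ z = z) → σ ∈ heckeStabilizer π.1)
    (hsmo : ∀ (n : ℕ) (K : Type) [Field K] [NumberField K]
      (hcpt : isCompact_glFiniteIntegralLevel n K) (π π' : CuspidalAutomorphicRepData n K hcpt),
      π.1.IsNearlyEquivalent π'.1 → ∀ T T' : InfinityType K n,
        π.1.HasInfinityType T → π'.1.HasInfinityType T' →
          ∀ ι : K →+* ℂ, (T ι).map ArchWeight.a = (T' ι).map ArchWeight.a) :
    Patrikis2019_cmDescent := by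
  intro F _ _ _hF n hcpt π T hT hreg halg ι ι' hιι'
  -- the regular algebraic (C-algebraic and regular) case, for any cuspidal `π₁` over `F`
  have key : ∀ (π₁ : CuspidalAutomorphicRepData n F hcpt) (T₁ : InfinityType F n),
      π₁.1.HasInfinityType T₁ → T₁.IsRegularAlgebraic →
      (T₁ ι).map ArchWeight.a = (T₁ ι').map ArchWeight.a := fun π₁ T₁ hT₁ hreg₁ ↦ by
    have hπ₁ : π₁.1.IsRegularAlgebraic := ⟨T₁, hT₁, hreg₁⟩
    haveI : FiniteDimensional ℚ (ratField π₁.1).toSubfield :=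
      hC.finiteDimensional_ratField π₁ hπ₁
    exact InfinityType.map_a_eq_of_autConj_invariance T₁ (ratField π₁.1).toSubfield
      (hC.isTotallyReal_or_isCMField π₁ hπ₁)
      (fun σ hσ ι₀ ↦ hC.map_a_autConj_eq_of_fix_ratField π₁ hT₁ hreg₁ (hmodel n F hcpt π₁ hπ₁)
        (fun π' hne T' hT' ↦ hsmo n F hcpt π₁ π' hne T₁ T' hT₁ hT') σ hσ ι₀)
      hιι'
  rcases halg with hCalg | hLalg
  · exact key π T hT ⟨hCalg, hreg⟩
  · rcases Nat.eq_zero_or_pos n with hn | hn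
    · -- `n = 0`: all multisets are empty
      subst hn
      have h0 : ∀ ι₀ : F →+* ℂ, T ι₀ = 0 := fun ι₀ ↦ Multiset.card_eq_zero.mp (hT.1.1 ι₀)
      rw [h0 ι, h0 ι']
    · -- `n ≥ 1`: twist by `|det|^{-(n-1)/2}` to a regular C-algebraic infinity type
      haveI : NeZero n := ⟨hn.ne'⟩
      obtain ⟨χ, π', -, -, -, hT'⟩ := π.exists_twist_hasInfinityType (-(((n : ℝ) - 1) / 2)) hT
      have hC' : (T.twist (((-(((n : ℝ) - 1) / 2) : ℝ) : ℂ))).IsCAlgebraic := by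
        have e : (((-(((n : ℝ) - 1) / 2) : ℝ)) : ℂ) = -(((n : ℂ) - 1) / 2) := by
          push_cast
          ring
        rw [e]
        exact (InfinityType.isLAlgebraic_iff_isCAlgebraic_twist T).mp hLalg
      have h := key π' _ hT' ⟨hC', hreg.twist _⟩
      rw [InfinityType.map_a_twist, InfinityType.map_a_twist] at h
      exact Multiset.map_injective (add_left_injective _) h

end Clozel

/-! ### The model clause from the printed form of Clozel's theorem

Hypothesis (a) of `Patrikis2019_cmDescent_of_clozel` — `Aut(ℂ/ℚ(π_f)) ≤ heckeStabilizer π` — is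
phrased in the tree's own terms (`ratField`, `heckeStabilizer`). In print it is a CONSEQUENCE of
the clause of Clozel's theorem that the vendored fact `Clozel1990_regularAlgebraic` omits:
"`π_f` has a model over the fixed field `ℚ(π_f)` …, with `ℚ(π_f)` in fact a number field"
(Patrikis 2019, Thm. 3.2.1 = Clozel 1990, Thm. 3.13 with Prop. 3.1), whence the unramified
Hecke eigenvalues `t_{v,i}` (eigenvalues of the `ℤ`-integral double-coset operators on the
`ℚ(π_f)`-line of spherical vectors of the model) lie in the number field `ℚ(π_f) ⊂ ℂ`. We show
that this printed clause, in the eigenvalue form "at almost all places the `t_{v,i}` lie in a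
subfield `E ⊆ ℂ` finite over `ℚ`", implies (a). The point (pure field theory,
`IntermediateField.exists_finset_forall_adjoin_eq` /
`IntermediateField.exists_finset_forall_apply_eq_of_eventually`): the fields `E_S ⊆ E` generated
by the eigenvalues outside a finite set `S` of places decrease with `S` inside the number field
`E`, so they are all equal to one of them, `E_{S₀}`, of least degree; consequently an
automorphism of `ℂ` fixing the eigenvalues at almost all places fixes `E_{S₀}` pointwise, and
conversely. So `heckeStabilizer π` is exactly the pointwise stabiliser of the number field
`E_{S₀}` (`AutomorphicRepData.exists_heckeStabilizer_iff_forall_apply_eq`), `ratField π = E_{S₀}`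
(`AutomorphicRepData.exists_ratField_eq_of_eventually_mem`, using that the fixed field of
`Aut(ℂ/E_{S₀})` is the countable field `E_{S₀}`), and an automorphism fixing `ratField π` lies in
the stabiliser (`AutomorphicRepData.mem_heckeStabilizer_of_fix_ratField`). (With the tree's
weaker clause (i), "`ratField π` is finite over `ℚ`", alone this does not follow: the `a.e.` in
`heckeStabilizer` lets the exceptional places depend on the automorphism.) -/

section ModelClause

/-- **Stabilisation of the fields generated by a cofinitely-`E`-valued family.** Let `L/K` be a
field extension, `E` an intermediate field finite over `K`, and `g : ι → Set L` a family of sets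
with `g i ⊆ E` for all but finitely many `i`. Then there is a finite set `S₀` of indices, beyond
which the `g i` lie in `E`, such that for every finite `S ⊇ S₀` the field generated over `K` by
the `g i`, `i ∉ S`, equals the one generated by the `g i`, `i ∉ S₀`: these fields decrease with
`S` and are intermediate fields of the finite extension `E/K`, so one of least degree is
contained in, hence equal to, all the later ones. [folklore] -/
theorem _root_.IntermediateField.exists_finset_forall_adjoin_eq {k L : Type*} [Field k]
    [Field L] [Algebra k L] {ι : Type*} (g : ι → Set L) (E : IntermediateField k L)
    [FiniteDimensional k E] (hg : ∀ᶠ i in Filter.cofinite, g i ⊆ E) :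
    ∃ S₀ : Finset ι, (∀ i ∉ S₀, g i ⊆ E) ∧ ∀ S : Finset ι, S₀ ⊆ S →
      IntermediateField.adjoin k {z : L | ∃ i ∉ S, z ∈ g i} =
        IntermediateField.adjoin k {z : L | ∃ i ∉ S₀, z ∈ g i} := by
  classical
  -- the generated fields decrease with `S`
  have hanti : ∀ {S S' : Finset ι}, S ⊆ S' →
      IntermediateField.adjoin k {z : L | ∃ i ∉ S', z ∈ g i} ≤
        IntermediateField.adjoin k {z : L | ∃ i ∉ S, z ∈ g i} := fun h ↦
    IntermediateField.adjoin.mono k _ _ fun z ⟨i, hi, hz⟩ ↦ ⟨i, fun hiS ↦ hi (h hiS), hz⟩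
  -- beyond the exceptional set `S₁` of `hg` they are subfields of `E`
  obtain ⟨S₁, hS₁⟩ : ∃ S₁ : Finset ι, ∀ i ∉ S₁, g i ⊆ E := by
    refine ⟨(Filter.eventually_cofinite.mp hg).toFinset, fun i hi ↦ ?_⟩
    by_contra h
    exact hi ((Filter.eventually_cofinite.mp hg).mem_toFinset.mpr h)
  have hle : ∀ {S : Finset ι}, S₁ ⊆ S →
      IntermediateField.adjoin k {z : L | ∃ i ∉ S, z ∈ g i} ≤ E := fun h ↦
    IntermediateField.adjoin_le_iff.mpr fun z ⟨i, hi, hz⟩ ↦ hS₁ i (fun hiS ↦ hi (h hiS)) hz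
  -- take `S₀ ⊇ S₁` of least degree
  have hex : ∃ m, ∃ S : Finset ι, S₁ ⊆ S ∧
      Module.finrank k (IntermediateField.adjoin k {z : L | ∃ i ∉ S, z ∈ g i}) = m :=
    ⟨_, S₁, Finset.Subset.refl _, rfl⟩
  obtain ⟨S₀, hS₀₁, hS₀m⟩ := Nat.find_spec hex
  refine ⟨S₀, fun i hi ↦ hS₁ i fun h ↦ hi (hS₀₁ h), fun S hS ↦ ?_⟩
  haveI : FiniteDimensional k (IntermediateField.adjoin k {z : L | ∃ i ∉ S₀, z ∈ g i}) :=
    Module.Finite.of_injective (IntermediateField.inclusion (hle hS₀₁)).toLinearMap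
      (IntermediateField.inclusion_injective (hle hS₀₁))
  refine IntermediateField.eq_of_le_of_finrank_le (hanti hS) ?_
  rw [hS₀m]
  exact Nat.find_min' hex ⟨S, hS₀₁.trans hS, rfl⟩

/-- **An endomorphism fixing a cofinitely-`E`-valued family at almost all indices fixes the
stable field it generates.** With `g`, `E` as in `IntermediateField.exists_finset_forall_adjoin_eq`
and `S₀` the finite set of indices it provides: every `K`-algebra endomorphism `f` of `L` with
`f z = z` for all `z ∈ g i`, for all but finitely many `i`, fixes pointwise the field generated
by the `g i`, `i ∉ S₀` — that field is also generated by the `g i` outside `S₀ ∪ {bad indices}`,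
on which `f` is the identity, and two ring homomorphisms agreeing on generators agree on the
generated subfield (`RingHom.eqOn_field_closure`). [folklore] -/
theorem _root_.IntermediateField.exists_finset_forall_apply_eq_of_eventually {k L : Type*}
    [Field k] [Field L] [Algebra k L] {ι : Type*} (g : ι → Set L) (E : IntermediateField k L)
    [FiniteDimensional k E] (hg : ∀ᶠ i in Filter.cofinite, g i ⊆ E) :
    ∃ S₀ : Finset ι, (∀ i ∉ S₀, g i ⊆ E) ∧ ∀ f : L →ₐ[k] L,
      (∀ᶠ i in Filter.cofinite, ∀ z ∈ g i, f z = z) →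
        ∀ z ∈ IntermediateField.adjoin k {z : L | ∃ i ∉ S₀, z ∈ g i}, f z = z := by
  classical
  obtain ⟨S₀, hS₀E, hstab⟩ := IntermediateField.exists_finset_forall_adjoin_eq g E hg
  refine ⟨S₀, hS₀E, fun f hf z hz ↦ ?_⟩
  -- the exceptional set `B` of `hf`
  obtain ⟨B, hB⟩ : ∃ B : Finset ι, ∀ i ∉ B, ∀ z ∈ g i, f z = z := by
    refine ⟨(Filter.eventually_cofinite.mp hf).toFinset, fun i hi ↦ ?_⟩
    by_contra h
    exact hi ((Filter.eventually_cofinite.mp hf).mem_toFinset.mpr h)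
  rw [← hstab (S₀ ∪ B) Finset.subset_union_left] at hz
  have hz' : z ∈ Subfield.closure
      (Set.range (algebraMap k L) ∪ {z : L | ∃ i ∉ S₀ ∪ B, z ∈ g i}) := by
    rw [← IntermediateField.adjoin_toSubfield]
    exact hz
  have key := RingHom.eqOn_field_closure (f := (f : L →+* L)) (g := RingHom.id L) ?_ hz'
  · simpa using key
  · rintro x (⟨q, rfl⟩ | ⟨i, hi, hx⟩)
    · simp
    · exact hB i (fun h ↦ hi (Finset.mem_union_right _ h)) x hx

variable {n : ℕ} {K : Type} [Field K] [NumberField K] {hcpt : isCompact_glFiniteIntegralLevel n K}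

/-- **If the unramified Hecke eigenvalues at almost all places lie in a number field `E ⊆ ℂ`,
the Hecke stabiliser is the pointwise stabiliser of a number field `E₀ ⊆ E`.** Namely `E₀` is
the field generated by the eigenvalues `t_{v,i}` at the places outside a suitable finite set `S₀`
(`IntermediateField.exists_finset_forall_apply_eq_of_eventually`): an automorphism fixing the
eigenvalues at almost all places fixes `E₀` pointwise, and one fixing `E₀` fixes the eigenvalues
at every `v ∉ S₀`. This is the tree's form of "`{σ : ^σπ_f ≅ π_f} = Aut(ℂ/ℚ(π_f))` when `π_f`
has a model over the number field `ℚ(π_f)`" (Clozel 1990, Prop. 3.1 and Thm. 3.13; Patrikis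
2019, Thm. 3.2.1: "`π_f` has a model over … `ℚ(π_f)` …, with `ℚ(π_f)` in fact a number field").
[cite: Patrikis2019, Thm. 3.2.1 (arXiv:1207.6724); Clozel1990 Thm. 3.13] -/
theorem AutomorphicRepData.exists_heckeStabilizer_iff_forall_apply_eq
    (π : AutomorphicRepData (AutomorphyDatum.gl n K hcpt)) (E : IntermediateField ℚ ℂ)
    [FiniteDimensional ℚ E]
    (hE : ∀ᶠ v : HeightOneSpectrum (𝓞 K) in Filter.cofinite, ∀ α : Multiset ℂ,
      π.HasSatakeParamAt v α → ∀ i ≤ n, heckeEigenvalueOf n v α i ∈ E) :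
    ∃ E₀ : IntermediateField ℚ ℂ, E₀ ≤ E ∧
      ∀ τ : ℂ ≃ₐ[ℚ] ℂ, τ ∈ heckeStabilizer π ↔ ∀ z ∈ E₀, τ z = z := by
  -- the eigenvalues at `v`, as a family of sets indexed by the finite places
  obtain ⟨S₀, hS₀E, hfix⟩ := IntermediateField.exists_finset_forall_apply_eq_of_eventually
    (k := ℚ) (L := ℂ)
    (fun v : HeightOneSpectrum (𝓞 K) ↦ {z : ℂ | ∃ α : Multiset ℂ, π.HasSatakeParamAt v α ∧
      ∃ i ≤ n, z = heckeEigenvalueOf n v α i}) E (by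
    filter_upwards [hE] with v hv
    rintro z ⟨α, hα, i, hi, rfl⟩
    exact hv α hα i hi)
  refine ⟨IntermediateField.adjoin ℚ {z : ℂ | ∃ v ∉ S₀, z ∈
      (fun v : HeightOneSpectrum (𝓞 K) ↦ {z : ℂ | ∃ α : Multiset ℂ, π.HasSatakeParamAt v α ∧
        ∃ i ≤ n, z = heckeEigenvalueOf n v α i}) v}, ?_, fun τ ↦ ⟨fun hτ ↦ ?_, fun hτ ↦ ?_⟩⟩
  · -- `E₀ ≤ E`
    exact IntermediateField.adjoin_le_iff.mpr fun z ⟨v, hv, hz⟩ ↦ hS₀E v hv hz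
  · -- a stabilising automorphism fixes `E₀`
    refine hfix (τ : ℂ →ₐ[ℚ] ℂ) ?_
    rw [mem_heckeStabilizer_iff] at hτ
    filter_upwards [hτ] with v hv
    rintro z ⟨α, hα, i, hi, rfl⟩
    exact hv α hα i hi
  · -- an automorphism fixing `E₀` fixes the eigenvalues at every `v ∉ S₀`
    rw [mem_heckeStabilizer_iff]
    filter_upwards [S₀.eventually_cofinite_notMem] with v hv α hα i hi
    exact hτ _ (IntermediateField.subset_adjoin ℚ _ ⟨v, hv, α, hα, i, hi, rfl⟩)

/-- **Under the printed model clause, `ℚ(π_f) = ratField π` is the number field generated by the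
Hecke eigenvalues at almost all places.** With `E₀ ⊆ E` the field of
`exists_heckeStabilizer_iff_forall_apply_eq` (generated by the `t_{v,i}`, `v ∉ S₀`):
`heckeStabilizer π` is the pointwise stabiliser of `E₀` in `Aut(ℂ)`, and its fixed field
`ratField π` IS `E₀` — `E₀ ⊆ ratField π` tautologically, and conversely an element fixed by
every automorphism of `ℂ` fixing the countable subfield `E₀` lies in `E₀`
(`Complex.mem_subfield_of_forall_ringEquiv`: the fixed field of `Aut(ℂ/E₀)` is `E₀`; Lang,
*Algebra*, VIII §1). In particular `ratField π ⊆ E` is a number field (clause (i) of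
`Clozel1990_regularAlgebraic`, cf. `finiteDimensional_ratField_of_heckeEigenvalue_mem`), as in
the proof of Clozel 1990, Thm. 3.13 ("`ℚ(π_f) ⊂ E`"). [cite: Clozel1990, Thm. 3.13 (proof, §3.5); Patrikis2019 Thm. 3.2.1 (arXiv:1207.6724)] -/
theorem AutomorphicRepData.exists_ratField_eq_of_eventually_mem
    (π : AutomorphicRepData (AutomorphyDatum.gl n K hcpt)) (E : IntermediateField ℚ ℂ)
    [FiniteDimensional ℚ E]
    (hE : ∀ᶠ v : HeightOneSpectrum (𝓞 K) in Filter.cofinite, ∀ α : Multiset ℂ,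
      π.HasSatakeParamAt v α → ∀ i ≤ n, heckeEigenvalueOf n v α i ∈ E) :
    ∃ E₀ : IntermediateField ℚ ℂ, E₀ ≤ E ∧ ratField π = E₀ ∧
      ∀ τ : ℂ ≃ₐ[ℚ] ℂ, τ ∈ heckeStabilizer π ↔ ∀ z ∈ E₀, τ z = z := by
  obtain ⟨E₀, hle, hE₀⟩ := π.exists_heckeStabilizer_iff_forall_apply_eq E hE
  refine ⟨E₀, hle, le_antisymm (fun z hz ↦ ?_) (fun z hz ↦ ?_), hE₀⟩
  · -- `ratField π ⊆ E₀`: the fixed field of `Aut(ℂ/E₀)` is the countable field `E₀`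
    haveI : FiniteDimensional ℚ E₀ :=
      Module.Finite.of_injective (IntermediateField.inclusion hle).toLinearMap
        (IntermediateField.inclusion_injective hle)
    have hcount : Cardinal.mk E₀.toSubfield ≤ Cardinal.aleph0 :=
      (Algebra.IsAlgebraic.cardinalMk_le_max ℚ E₀).trans (by simp)
    refine Literature.FieldTheory.AlgClosed.Complex.mem_subfield_of_forall_ringEquiv
      E₀.toSubfield hcount fun σ hσ ↦ ?_
    -- an automorphism of `ℂ` is a `ℚ`-algebra automorphism; one fixing `E₀` stabilises `π`
    let σ' : ℂ ≃ₐ[ℚ] ℂ := AlgEquiv.ofRingEquiv (f := σ) fun q ↦ by simp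
    have hmem : σ' ∈ heckeStabilizer π := (hE₀ σ').mpr fun x hx ↦ hσ x hx
    exact (mem_ratField_iff π z).mp hz σ' hmem
  · -- `E₀ ⊆ ratField π`: the stabiliser fixes `E₀`
    exact (mem_ratField_iff π z).mpr fun τ hτ ↦ (hE₀ τ).mp hτ z hz

/-- **The model clause (a) of `Patrikis2019_cmDescent_of_clozel` from the printed form of
Clozel's theorem.** If at almost all finite places the unramified Hecke eigenvalues of `π` lie
in a subfield `E ⊆ ℂ` finite over `ℚ` (Clozel 1990, Thm. 3.13 with Prop. 3.1; Patrikis 2019,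
Thm. 3.2.1: `π_f` has a model over the number field `ℚ(π_f)`), then every automorphism of `ℂ`
fixing `ratField π = ℚ(π_f)` pointwise lies in `heckeStabilizer π`: by
`exists_heckeStabilizer_iff_forall_apply_eq` the stabiliser is the pointwise stabiliser of a
number field `E₀`, so `E₀ ⊆ ratField π` (the fixed field of the stabiliser), and an
automorphism fixing `ratField π` fixes `E₀`. [cite: Patrikis2019, Thm. 3.2.1 (arXiv:1207.6724); Clozel1990 Thm. 3.13] -/
theorem AutomorphicRepData.mem_heckeStabilizer_of_fix_ratField
    (π : AutomorphicRepData (AutomorphyDatum.gl n K hcpt)) (E : IntermediateField ℚ ℂ)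
    [FiniteDimensional ℚ E]
    (hE : ∀ᶠ v : HeightOneSpectrum (𝓞 K) in Filter.cofinite, ∀ α : Multiset ℂ,
      π.HasSatakeParamAt v α → ∀ i ≤ n, heckeEigenvalueOf n v α i ∈ E)
    (σ : ℂ ≃ₐ[ℚ] ℂ) (hσ : ∀ z ∈ ratField π, σ z = z) : σ ∈ heckeStabilizer π := by
  obtain ⟨E₀, -, hE₀⟩ := π.exists_heckeStabilizer_iff_forall_apply_eq E hE
  refine (hE₀ σ).mpr fun z hz ↦ hσ z ?_
  rw [mem_ratField_iff]
  exact fun τ hτ ↦ (hE₀ τ).mp hτ z hz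

/-- **`Patrikis2019_cmDescent` from Clozel's theorem in its printed form and strong multiplicity
one.** As `Patrikis2019_cmDescent_of_clozel`, with hypothesis (a) replaced by the printed clause
of Clozel's theorem it renders: for every cuspidal regular algebraic `π`, at almost all finite
places the unramified Hecke eigenvalues lie in a subfield of `ℂ` finite over `ℚ` ("`π_f` has a
model over … `ℚ(π_f)` …, with `ℚ(π_f)` in fact a number field", Patrikis 2019, Thm. 3.2.1 =
Clozel 1990, Thm. 3.13); (a) then holds by `AutomorphicRepData.mem_heckeStabilizer_of_fix_ratField`.
So the named fact follows from: `Clozel1990_regularAlgebraic`, this eigenvalue clause, and strong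
multiplicity one with archimedean components (Jacquet–Shalika 1981, Thm. 4.8) — the three
inputs of Patrikis's Rem. 3.2.4 (1) ("if `π` is regular, this yields an unconditional descent
result"). [cite: Patrikis2019, Prop. 3.2.3 `cmdescent` and Rem. 3.2.4 (1) (arXiv:1207.6724; Mem. AMS numbering Prop. 2.4.7, Rem. 2.4.8 (1))] -/
theorem Patrikis2019_cmDescent_of_clozel_of_eigenvalueField (hC : Clozel1990_regularAlgebraic)
    (hdef : ∀ (n : ℕ) (K : Type) [Field K] [NumberField K]
      (hcpt : isCompact_glFiniteIntegralLevel n K) (π : CuspidalAutomorphicRepData n K hcpt),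
      π.1.IsRegularAlgebraic →
        ∃ E : IntermediateField ℚ ℂ, FiniteDimensional ℚ E ∧
          ∀ᶠ v : HeightOneSpectrum (𝓞 K) in Filter.cofinite, ∀ α : Multiset ℂ,
            π.1.HasSatakeParamAt v α → ∀ i ≤ n, heckeEigenvalueOf n v α i ∈ E)
    (hsmo : ∀ (n : ℕ) (K : Type) [Field K] [NumberField K]
      (hcpt : isCompact_glFiniteIntegralLevel n K) (π π' : CuspidalAutomorphicRepData n K hcpt),
      π.1.IsNearlyEquivalent π'.1 → ∀ T T' : InfinityType K n,
        π.1.HasInfinityType T → π'.1.HasInfinityType T' →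
          ∀ ι : K →+* ℂ, (T ι).map ArchWeight.a = (T' ι).map ArchWeight.a) :
    Patrikis2019_cmDescent :=
  Patrikis2019_cmDescent_of_clozel hC (fun n K _ _ hcpt π hπ σ hσ ↦ by
    obtain ⟨E, hEfd, hE⟩ := hdef n K hcpt π hπ
    haveI := hEfd
    exact π.1.mem_heckeStabilizer_of_fix_ratField E hE σ hσ) hsmo

end ModelClause

end Literature.NumberTheory.Automorphic
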